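import Summits.QuantumFields.YangMills.Theorems.SwapVirialDeficitSectorLaplaceDefs
import Summits.QuantumFields.YangMills.Theorems.SwapVirialDeficitBlowUpPeriodicHub
import HarnessLib

/-!
# THE HUB IS ONE GNOMONIC LETTER: `∫ G(re a ∕ ‖Im a‖) dcone = coneConst·π·∫_ℝ G(δ)(1+δ²)⁻² dδ`, and `F̂_{a,ε} = F̂_{hubAt δ 1, ε}` with `δ = cot ψ = re a ∕ ‖Im a‖`
# (free-hands support of ⟨stmt-QuantumFields-24197⟩ `SwapVirialDeficit.SwapGluedStiffness` ∕ ⟨24194⟩; cell ym-idea-1, LEAD g98 ➎: the «δ-in-fibre fibred lemma» for the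
# stratum-B tubes (S-B) and for sector 001 (19:28Z) — its hub half)

The gnomonic deficit `F̂_{z,a,ε}(η)` (✓`gnoDeficit`) sees the cone hub `a ∈ ℍ` only through the Weyl-reduced axial unit `radialUnit (axisPoint a)`
(✓`leaderTuple`), i.e. through the ONE real letter `δ := re a ∕ ‖Im a‖ = cot ψ`; and against ✓`coneMeasure` a function of `δ` integrates as
`coneConst·π·∫_ℝ G(δ)·((1+δ²)⁻¹)² dδ` — a flat letter with the gnomonic weight (total mass `(2∕π²)·π·(π∕2) = 1`).  Hence every ➎ region integral
`∫_R e^{−bF̂_ε} d(chartMeasure)` is an integral over `ℝ × GnoCoord L` against `((1+δ²)⁻¹)² dδ ⊗ ρ(η)dη`, and a region whose Laplace variable includes the hub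
(the B-tubes: `δ → 0`; sector 001) is an ORDINARY Euclidean fibred law with `δ` among the fibre letters — no `ℍ`-reshuffle, no `Im a`-base.
* §1 `axisPoint_eq_smul_hubAt`, `radialUnit_axisPoint_hubCot`, ★ `gnoDeficit_eq_hubCot (him : a.im ≠ 0) : gnoDeficit z χ a ε η = gnoDeficit z χ (hubAt (a.re ∕ ‖a.im‖) 1) ε η`;
* §2 `lintegral_comp_mul_left_pos`, `lintegral_Ioi_cube_indicator` (`∫_{ρ>0}𝟙{ρ²(1+δ²)<1}ρ³ = ((1+δ²)⁻¹)²∕4`), ★★★ `lintegral_coneMeasure_hubCot (G) (hG) :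
  ∫⁻ a, G (a.re ∕ ‖a.im‖) ∂coneMeasure = ofReal (coneConst·π) * ∫⁻ δ, G δ * ofReal ((1+δ²)⁻¹)²` (g44 ✓`lintegral_coneMeasure_re_normSqIm′` + `a₀ = δρ` + Tonelli);
* §3 ★★ `lintegral_chartMeasure_hubCot` — the same against `chartMeasure L = cone ⊗ ρdη` for jointly measurable `H(δ, η)`.

HONEST LABEL: measure-theoretic plumbing; the B-tube ∕ 001 laws, all region stubs, ⟨24197⟩ ∕ ⟨24194⟩ OPEN; own crux ⟨22884⟩ `LargeFieldMassRefinementTail` OPEN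
(blocked-on ⟨19935⟩); the Yang–Mills mass gap is NOT proved; no summit is proved by a line.  THEOREMS ONLY (0 `def`, 0 `sorry`; the series' local `ℍ` instances),
standard axioms.  Width seat ym-line-sfw-p2-w2 g59 (cell ym-idea-1, free hands), `--supports stmt-QuantumFields-24197`.  References: [folklore]; [cite: tHooft1979].
-/

set_option autoImplicit false

noncomputable section

open MeasureTheory Quaternion Set
open scoped Quaternion ENNReal BigOperators
open Literature.MathematicalPhysics.QuantumLattice
open Literature.MathematicalPhysics.QuantumFieldTheory hiding SU2
open Literature.Analysis.Calculus (radialUnit radialUnit_def)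
open Summit.QuantumFields.YangMills.Theorems.SwapTwistDeficit.ToronLog

attribute [local instance] Literature.Analysis.FluidPDE.Tao2016.quatMeasurableSpace
  Literature.Analysis.FluidPDE.Tao2016.quatBorelSpace
  Literature.MathematicalPhysics.QuantumLattice.secondCountableTopology_su2

namespace Summit.QuantumFields.YangMills.Theorems.SwapVirialDeficit.BlowUpRing

open Summit.QuantumFields.YangMills.Theorems.FemtoTransferGap
open Summit.QuantumFields.YangMills.Theorems.FemtoTransferGap.TT
open Summit.QuantumFields.YangMills.Theorems.VirialFluxGap.RingDeficit
open Summit.QuantumFields.YangMills.Theorems.SwapVirialDeficit.BlowUp (leaderTuple)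
open Summit.QuantumFields.YangMills.Theorems.SwapVirialDeficit.ZeroModeGroup (lintegral_coneMeasure_re_normSqIm')
open Summit.QuantumFields.YangMills.Theorems.SwapVirialDeficit.SectorLaplace (fibreMeasure chartMeasure)

variable {L : ℕ} [NeZero L]

/-! ## §1 The deficit sees the hub through `δ = re a ∕ ‖Im a‖` only -/

omit [NeZero L] in
/-- `axisPoint a = ‖Im a‖ • hubAt (re a ∕ ‖Im a‖) 1` for `Im a ≠ 0`. [folklore] -/
theorem axisPoint_eq_smul_hubAt {a : ℍ} (him : a.im ≠ 0) : axisPoint a = ‖a.im‖ • hubAt (a.re / ‖a.im‖) 1 := by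
  have h0 : ‖a.im‖ ≠ 0 := norm_ne_zero_iff.2 him
  rw [axisPoint, hubAt, Real.sqrt_one]
  ext <;> simp
  rw [mul_div_cancel₀ _ h0]

omit [NeZero L] in
/-- The hub enters only through `δ = re a ∕ ‖Im a‖`: `radialUnit (axisPoint a) = radialUnit (axisPoint (hubAt δ 1))`. [folklore] -/
theorem radialUnit_axisPoint_hubCot {a : ℍ} (him : a.im ≠ 0) :
    radialUnit (axisPoint a) = radialUnit (axisPoint (hubAt (a.re / ‖a.im‖) 1)) := by
  rw [axisPoint_eq_smul_hubAt him, radialUnit_smul_of_pos (norm_pos_iff.2 him), axisPoint_hubAt]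

/-- ★ **THE DEFICIT DEPENDS ON THE HUB ONLY THROUGH `δ = cot ψ = re a ∕ ‖Im a‖`**: `F̂_{z,a,ε}(η) = F̂_{z, hubAt δ 1, ε}(η)` (`Im a ≠ 0`). [folklore] -/
theorem gnoDeficit_eq_hubCot (z : Fin 3 → Bool) (χ : Site 3 L → SU2) {a : ℍ} (him : a.im ≠ 0) (ε : GnoSign L) (η : GnoCoord L) :
    gnoDeficit z χ a ε η = gnoDeficit z χ (hubAt (a.re / ‖a.im‖) 1) ε η := by
  unfold gnoDeficit blowUpPoint gnomonicPoint
  simp only [leaderTuple, radialUnit_axisPoint_hubCot him]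


/-! ## §2 The cone measure in the letter `δ` -/

omit [NeZero L] in
/-- Dilation change of variables on `ℝ`: `∫ K(ρδ) dδ = ρ⁻¹ ∫ K(r) dr` for `ρ > 0`. [folklore] -/
theorem lintegral_comp_mul_left_pos (K : ℝ → ℝ≥0∞) {ρ : ℝ} (hρ : 0 < ρ) :
    ∫⁻ δ, K (ρ * δ) = ENNReal.ofReal ρ⁻¹ * ∫⁻ r, K r := by
  have h1 : ∫⁻ δ, K (ρ * δ) = ∫⁻ r, K r ∂(Measure.map (fun δ => ρ * δ) volume) := by
    rw [show (fun δ => ρ * δ) = ⇑(Homeomorph.mulLeft₀ ρ hρ.ne').toMeasurableEquiv from rfl, lintegral_map_equiv]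
    rfl
  rw [h1, Real.map_volume_mul_left hρ.ne', lintegral_smul_measure, smul_eq_mul, abs_of_pos (inv_pos.2 hρ)]

omit [NeZero L] in
/-- `∫_{ρ>0} 𝟙{ρ²(1+δ²) < 1}·ρ³ dρ = ((1+δ²)⁻¹)²/4`. [folklore] -/
theorem lintegral_Ioi_cube_indicator (δ : ℝ) :
    ∫⁻ ρ in Ioi (0 : ℝ), {ρ : ℝ | ρ ^ 2 * (1 + δ ^ 2) < 1}.indicator (fun ρ => ENNReal.ofReal (ρ ^ 3)) ρ =
      ENNReal.ofReal (((1 + δ ^ 2)⁻¹) ^ 2 / 4) := by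
  have hd : 0 < 1 + δ ^ 2 := by positivity
  set c : ℝ := Real.sqrt ((1 + δ ^ 2)⁻¹) with hc
  have hc0 : 0 < c := Real.sqrt_pos.2 (inv_pos.2 hd)
  have hc2 : c ^ 2 = (1 + δ ^ 2)⁻¹ := Real.sq_sqrt (inv_pos.2 hd).le
  have hS : MeasurableSet {ρ : ℝ | ρ ^ 2 * (1 + δ ^ 2) < 1} :=
    measurableSet_lt ((measurable_id.pow_const 2).mul_const _) measurable_const
  rw [lintegral_indicator hS, Measure.restrict_restrict hS]
  have hset : {ρ : ℝ | ρ ^ 2 * (1 + δ ^ 2) < 1} ∩ Ioi 0 = Ioo 0 c := by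
    ext ρ
    simp only [mem_inter_iff, mem_setOf_eq, mem_Ioi, mem_Ioo]
    constructor
    · rintro ⟨h1, h2⟩
      refine ⟨h2, ?_⟩
      refine lt_of_not_ge fun hle => ?_
      have : c ^ 2 ≤ ρ ^ 2 := pow_le_pow_left₀ hc0.le hle 2
      rw [hc2] at this
      have := mul_le_mul_of_nonneg_right this hd.le
      rw [inv_mul_cancel₀ hd.ne'] at this
      linarith
    · rintro ⟨h1, h2⟩
      refine ⟨?_, h1⟩
      have : ρ ^ 2 < c ^ 2 := pow_lt_pow_left₀ h2 h1.le (by norm_num)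
      rw [hc2] at this
      have := mul_lt_mul_of_pos_right this hd
      rwa [inv_mul_cancel₀ hd.ne'] at this
  rw [hset]
  have hint : IntegrableOn (fun ρ : ℝ => ρ ^ 3) (Ioo 0 c) := (continuous_pow 3).integrableOn_Icc.mono_set Ioo_subset_Icc_self
  rw [← ofReal_integral_eq_lintegral_ofReal hint ((ae_restrict_iff' measurableSet_Ioo).2 (ae_of_all _ fun ρ hρ => pow_nonneg hρ.1.le 3))]
  congr 1
  rw [← intervalIntegral.integral_of_le hc0.le |>.trans (integral_Ioc_eq_integral_Ioo), integral_pow]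
  rw [show ((1 + δ ^ 2)⁻¹) ^ 2 = c ^ 4 by rw [← hc2]; ring]
  norm_num

omit [NeZero L] in
/-- ★★★ **THE HUB IS ONE GNOMONIC LETTER**: for every measurable `G : ℝ → ℝ≥0∞`,
`∫ G(a.re ∕ ‖a.im‖) dcone(a) = coneConst·π · ∫_ℝ G(δ)·((1+δ²)⁻¹)² dδ` (`δ = cot ψ`; ✓`lintegral_coneMeasure_re_normSqIm′` and the substitution `a₀ = δρ`,
`∫₀^{(1+δ²)^{−1∕2}} 4πρ³ dρ = π((1+δ²)⁻¹)²`). [folklore] -/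
theorem lintegral_coneMeasure_hubCot (G : ℝ → ℝ≥0∞) (hG : Measurable G) :
    ∫⁻ a, G (a.re / ‖a.im‖) ∂coneMeasure = ENNReal.ofReal (coneConst * Real.pi) * ∫⁻ δ, G δ * ENNReal.ofReal (((1 + δ ^ 2)⁻¹) ^ 2) := by
  -- the hub function in the coordinates `(a₀, ‖Im a‖²)`
  have hF : Measurable (Function.uncurry fun r s : ℝ => G (r / Real.sqrt s)) :=
    hG.comp (measurable_fst.div (Real.continuous_sqrt.measurable.comp measurable_snd))
  have e0 : (fun a : ℍ => G (a.re / ‖a.im‖)) = fun a : ℍ => (fun r s : ℝ => G (r / Real.sqrt s)) a.re (‖a.im‖ ^ 2) := by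
    funext a; simp only [Real.sqrt_sq (norm_nonneg _)]
  rw [e0, lintegral_coneMeasure_re_normSqIm' _ hF]
  -- the two-variable integrand
  set H : ℝ → ℝ → ℝ≥0∞ := fun r ρ => {ρ : ℝ | r ^ 2 + ρ ^ 2 < 1}.indicator (fun ρ => ENNReal.ofReal (ρ ^ 2) * G (r / Real.sqrt (ρ ^ 2))) ρ with hH
  have hHm : Measurable (Function.uncurry H) := by
    have hset : MeasurableSet {p : ℝ × ℝ | p.1 ^ 2 + p.2 ^ 2 < 1} :=
      measurableSet_lt ((measurable_fst.pow_const 2).add (measurable_snd.pow_const 2)) measurable_const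
    have hfun : Measurable fun p : ℝ × ℝ => ENNReal.ofReal (p.2 ^ 2) * G (p.1 / Real.sqrt (p.2 ^ 2)) :=
      (ENNReal.measurable_ofReal.comp (measurable_snd.pow_const 2)).mul
        (hG.comp (measurable_fst.div (Real.continuous_sqrt.measurable.comp (measurable_snd.pow_const 2))))
    have e : Function.uncurry H = {p : ℝ × ℝ | p.1 ^ 2 + p.2 ^ 2 < 1}.indicator fun p => ENNReal.ofReal (p.2 ^ 2) * G (p.1 / Real.sqrt (p.2 ^ 2)) := by
      funext p
      simp only [Function.uncurry, hH, Set.indicator, mem_setOf_eq]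
    rw [e]; exact hfun.indicator hset
  -- (i) swap the order
  have hswap : ∫⁻ r, ENNReal.ofReal (4 * Real.pi) * ∫⁻ ρ in Ioi (0 : ℝ), H r ρ = ENNReal.ofReal (4 * Real.pi) * ∫⁻ ρ in Ioi (0 : ℝ), ∫⁻ r, H r ρ := by
    rw [lintegral_const_mul' _ _ ENNReal.ofReal_ne_top, lintegral_lintegral_swap (hHm.aemeasurable)]
  rw [hswap]
  -- (ii) substitute `r = ρδ` in the inner integral, for `ρ > 0`
  have hinner : ∀ ρ ∈ Ioi (0 : ℝ), ∫⁻ r, H r ρ =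
      ENNReal.ofReal (ρ ^ 3) * ∫⁻ δ, {δ : ℝ | ρ ^ 2 * (1 + δ ^ 2) < 1}.indicator (fun δ => G δ) δ := by
    intro ρ hρ
    have hρ0 : 0 < ρ := hρ
    have hsq : Real.sqrt (ρ ^ 2) = ρ := Real.sqrt_sq hρ0.le
    have hsub := lintegral_comp_mul_left_pos (fun r => H r ρ) hρ0
    -- `∫ H(ρδ) dδ = ρ⁻¹ ∫ H(r) dr`
    have e1 : (fun δ => H (ρ * δ) ρ) = fun δ => {δ : ℝ | ρ ^ 2 * (1 + δ ^ 2) < 1}.indicator (fun δ => ENNReal.ofReal (ρ ^ 2) * G δ) δ := by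
      funext δ
      simp only [hH, Set.indicator, mem_setOf_eq, hsq, mul_div_cancel_left₀ _ hρ0.ne']
      have : (ρ * δ) ^ 2 + ρ ^ 2 = ρ ^ 2 * (1 + δ ^ 2) := by ring
      rw [this]
    rw [e1] at hsub
    have hρinv : ENNReal.ofReal ρ⁻¹ ≠ 0 := by rw [Ne, ENNReal.ofReal_eq_zero, not_le]; exact inv_pos.2 hρ0
    have : ∫⁻ r, H r ρ = ENNReal.ofReal ρ * ∫⁻ δ, {δ : ℝ | ρ ^ 2 * (1 + δ ^ 2) < 1}.indicator (fun δ => ENNReal.ofReal (ρ ^ 2) * G δ) δ := by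
      rw [hsub, ← mul_assoc, ← ENNReal.ofReal_mul hρ0.le, mul_inv_cancel₀ hρ0.ne', ENNReal.ofReal_one, one_mul]
    rw [this]
    have e2 : (fun δ => {δ : ℝ | ρ ^ 2 * (1 + δ ^ 2) < 1}.indicator (fun δ => ENNReal.ofReal (ρ ^ 2) * G δ) δ) =
        fun δ => ENNReal.ofReal (ρ ^ 2) * {δ : ℝ | ρ ^ 2 * (1 + δ ^ 2) < 1}.indicator (fun δ => G δ) δ := by
      funext δ; simp only [Set.indicator]; split_ifs <;> simp
    rw [e2, lintegral_const_mul' _ _ ENNReal.ofReal_ne_top, ← mul_assoc, ← ENNReal.ofReal_mul hρ0.le]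
    congr 2; ring
  rw [setLIntegral_congr_fun measurableSet_Ioi hinner]
  -- (iii) swap back
  set K : ℝ → ℝ → ℝ≥0∞ := fun ρ δ => ENNReal.ofReal (ρ ^ 3) * {δ : ℝ | ρ ^ 2 * (1 + δ ^ 2) < 1}.indicator (fun δ => G δ) δ with hK
  have hKm : Measurable (Function.uncurry K) := by
    have hset : MeasurableSet {p : ℝ × ℝ | p.1 ^ 2 * (1 + p.2 ^ 2) < 1} :=
      measurableSet_lt ((measurable_fst.pow_const 2).mul (measurable_const.add (measurable_snd.pow_const 2))) measurable_const
    have e : Function.uncurry K = fun p : ℝ × ℝ => ENNReal.ofReal (p.1 ^ 3) * {p : ℝ × ℝ | p.1 ^ 2 * (1 + p.2 ^ 2) < 1}.indicator (fun p => G p.2) p := by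
      funext p
      simp only [Function.uncurry, hK, Set.indicator, mem_setOf_eq]
    rw [e]
    exact (ENNReal.measurable_ofReal.comp (measurable_fst.pow_const 3)).mul ((hG.comp measurable_snd).indicator hset)
  have hswap2 : ∫⁻ ρ in Ioi (0 : ℝ), ENNReal.ofReal (ρ ^ 3) * ∫⁻ δ, {δ : ℝ | ρ ^ 2 * (1 + δ ^ 2) < 1}.indicator (fun δ => G δ) δ =
      ∫⁻ δ, ∫⁻ ρ in Ioi (0 : ℝ), K ρ δ := by
    have e : ∀ ρ, ENNReal.ofReal (ρ ^ 3) * ∫⁻ δ, {δ : ℝ | ρ ^ 2 * (1 + δ ^ 2) < 1}.indicator (fun δ => G δ) δ = ∫⁻ δ, K ρ δ := fun ρ => by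
      rw [hK, lintegral_const_mul' _ _ ENNReal.ofReal_ne_top]
    simp_rw [e]
    exact lintegral_lintegral_swap hKm.aemeasurable
  rw [hswap2]
  -- (iv) the inner `ρ`-integral
  have hin : ∀ δ : ℝ, ∫⁻ ρ in Ioi (0 : ℝ), K ρ δ = G δ * ENNReal.ofReal (((1 + δ ^ 2)⁻¹) ^ 2 / 4) := by
    intro δ
    have e : ∀ ρ, K ρ δ = {ρ : ℝ | ρ ^ 2 * (1 + δ ^ 2) < 1}.indicator (fun ρ => ENNReal.ofReal (ρ ^ 3)) ρ * G δ := fun ρ => by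
      simp only [hK, Set.indicator, mem_setOf_eq]
      split_ifs <;> simp [mul_comm]
    simp_rw [e]
    have hm : Measurable fun ρ : ℝ => {ρ : ℝ | ρ ^ 2 * (1 + δ ^ 2) < 1}.indicator (fun ρ => ENNReal.ofReal (ρ ^ 3)) ρ :=
      (ENNReal.measurable_ofReal.comp (measurable_id.pow_const 3)).indicator (measurableSet_lt ((measurable_id.pow_const 2).mul_const _) measurable_const)
    rw [lintegral_mul_const _ hm, lintegral_Ioi_cube_indicator, mul_comm]
  simp_rw [hin]
  -- (v) constants
  have e4 : ∀ δ : ℝ, G δ * ENNReal.ofReal (((1 + δ ^ 2)⁻¹) ^ 2 / 4) = ENNReal.ofReal (1 / 4) * (G δ * ENNReal.ofReal (((1 + δ ^ 2)⁻¹) ^ 2)) := fun δ => by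
    rw [div_eq_mul_one_div, ENNReal.ofReal_mul (sq_nonneg _)]; ring
  simp_rw [e4]
  rw [lintegral_const_mul' _ _ ENNReal.ofReal_ne_top, ← mul_assoc, ← mul_assoc, ← ENNReal.ofReal_mul coneConst_pos.le,
    ← ENNReal.ofReal_mul (mul_nonneg coneConst_pos.le (by positivity))]
  congr 2
  ring


/-! ## §3 The chart measure in the letter `δ` -/

/-- ★★ **THE ➎ CHART MEASURE IN THE HUB LETTER**: for jointly measurable `H : ℝ × GnoCoord L → ℝ≥0∞`,
`∫ H(re a ∕ ‖Im a‖, η) d(chartMeasure L)(a,η) = coneConst·π · ∫∫ H(δ, η)·((1+δ²)⁻¹)² dδ ρ(η)dη` (product `volume ⊗ fibreMeasure L` on `ℝ × GnoCoord L`). [folklore] -/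
theorem lintegral_chartMeasure_hubCot (H : ℝ × GnoCoord L → ℝ≥0∞) (hH : Measurable H) :
    ∫⁻ x, H (x.1.re / ‖x.1.im‖, x.2) ∂(chartMeasure L) =
      ENNReal.ofReal (coneConst * Real.pi) * ∫⁻ q, H q * ENNReal.ofReal (((1 + q.1 ^ 2)⁻¹) ^ 2) ∂((volume : Measure ℝ).prod (fibreMeasure L)) := by
  haveI := isProbabilityMeasure_coneMeasure
  haveI : SFinite (fibreMeasure L) := by unfold fibreMeasure; infer_instance
  have hδ : Measurable fun a : ℍ => a.re / ‖a.im‖ :=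
    (Quaternion.continuous_re.measurable).div (Quaternion.continuous_im.measurable.norm)
  have hHx : Measurable fun x : ℍ × GnoCoord L => H (x.1.re / ‖x.1.im‖, x.2) := hH.comp ((hδ.comp measurable_fst).prodMk measurable_snd)
  have hW : Measurable fun q : ℝ × GnoCoord L => H q * ENNReal.ofReal (((1 + q.1 ^ 2)⁻¹) ^ 2) :=
    hH.mul (ENNReal.measurable_ofReal.comp (((measurable_const.add (measurable_fst.pow_const 2)).inv).pow_const 2))
  have hG : Measurable fun δ : ℝ => ∫⁻ η, H (δ, η) ∂fibreMeasure L := hH.lintegral_prod_right'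
  unfold chartMeasure
  rw [lintegral_prod _ hHx.aemeasurable, lintegral_prod _ hW.aemeasurable]
  change ∫⁻ a, (fun δ => ∫⁻ η, H (δ, η) ∂fibreMeasure L) (a.re / ‖a.im‖) ∂coneMeasure = _
  rw [lintegral_coneMeasure_hubCot _ hG]
  congr 1
  refine lintegral_congr fun δ => ?_
  exact (lintegral_mul_const _ (hH.comp (measurable_const.prodMk measurable_id))).symm

end Summit.QuantumFields.YangMills.Theorems.SwapVirialDeficit.BlowUpRing

end
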